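import Summits.Ventures.PercRepro.RankLevelSetUpPieces
import Summits.Ventures.PercRepro.RankLevelSetUpClassCut

/-! # RankLevelSetUpFiveSort — THE EXACT DECOMPOSITIONS OF `T_5` AND `V_6` ALONG A PARALLEL CLASS, THE NAMED
RESIDUE (C1) OF THE SERIES-TRIPLE CASE OF (↑)₅, AND `g_4 ≤ ḡ_5` (night-1 g39; dossier §51.8–51.10; on
`RankLevelSetUpPieces` and `RankLevelSetUpClassCut`)

A through-`b` bi-spanning `5`-set meets the class in `≤ 2` elements and an avoid-`b` bi-spanning `6`-set in `≤ 3`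
(**`not_four_parallel_of_spanning_six`**), so the piece bijections of `RankLevelSetUpPieces` give the exact sorts
**`through_five_eq_of_three_le`** (`T_5 = A_5 + q·g_4 + C(q,2)·g_3`, `q ≥ 3`), **`through_five_eq_of_two`**
(`T_5 = A_5 + 2·g_4 + g_3^{sp}`, `q = 2`), **`avoid_six_eq_of_four_le`** (`V_6 = Ā_6 + q·ḡ_5 + C(q,2)·ḡ_4 +
C(q,3)·ḡ_3`, `q ≥ 4`), **`avoid_six_eq_of_three`** (`V_6 = Ā_6 + 3ḡ_5 + 3ḡ_4 + ḡ_3^{sp}`, `q = 3`) and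
**`avoid_six_eq_of_two`** (`V_6 = Ā_6 + 2ḡ_5 + ḡ_4^{sp}`, `q = 2`). **`UpFiveResidue`** is the statement
`g_3 + ḡ_4^{sp} ≤ ḡ_4 + ḡ_3^{sp} + g_3^{sp}` (a `Prop`, NOT asserted; census 0 / 800,427) to which the case
`q = 3` of (↑)₅ reduces (`RankLevelSetUpFiveSeries`), and **`throughHat_four_le_avoidHat_five`** is `g_4 ≤ ḡ_5` for
`#E' ≥ 10` ((↑)₄ of the nullity-`3` deletion). The new families transport along the deletion of parallel copies
(**`throughSp_delete_parallel`**, **`avoidSp_delete_parallel`**). Every declaration has a docstring; imports: the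
cell's own modules and Mathlib only. Axioms: standard. -/

namespace PercRepro

open Set Matroid

variable {α : Type}

/-- **A spanning `6`-set of a rank-`4` matroid contains no four distinct parallel elements**: deleting one of them
leaves a spanning `5`-set with three. -/
lemma not_four_parallel_of_spanning_six {N : Matroid α} [N.Finite] (hnl : ∀ e ∈ N.E, N.IsNonloop e)
    (hr : N.eRank = 4) {Z : Set α} (hZ : N.Spanning Z) (hZ6 : Z.ncard = 6) {p x y z w : α} (hx : x ∈ Z)
    (hy : y ∈ Z) (hz : z ∈ Z) (hw : w ∈ Z) (hxy : x ≠ y) (hxz : x ≠ z) (hyz : y ≠ z) (hxw : x ≠ w) (hyw : y ≠ w)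
    (hzw : z ≠ w) (hxP : x ∈ N.closure {p}) (hyP : y ∈ N.closure {p}) (hzP : z ∈ N.closure {p})
    (hwP : w ∈ N.closure {p}) : False := by
  have hxnl : N.IsNonloop x := hnl x (hZ.subset_ground hx)
  have hclx : N.closure {x} = N.closure {p} := hxnl.closure_eq_of_mem_closure hxP
  have hw' : w ∈ N.closure (Z \ {w}) := by
    have : w ∈ N.closure {x} := by rw [hclx]; exact hwP
    have hxZ' : x ∈ Z \ {w} := ⟨hx, fun h => hxw (by simpa using h)⟩
    exact N.closure_subset_closure (Set.singleton_subset_iff.mpr hxZ') this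
  have hsp : N.Spanning (Z \ {w}) := (spanning_sdiff_singleton_iff hZ hw).mpr hw'
  have h5 : (Z \ {w}).ncard = 5 := by rw [Set.ncard_sdiff_singleton_of_mem hw, hZ6]
  exact not_three_parallel_of_spanning_five hnl hr hsp h5 (p := p) ⟨hx, fun h => hxw (by simpa using h)⟩
    ⟨hy, fun h => hyw (by simpa using h)⟩ ⟨hz, fun h => hzw (by simpa using h)⟩ hxy hxz hyz hxP hyP hzP

variable (N : Matroid α) [N.Finite]

/-! ## The partition sums -/

/-- **`T_5` is the sum of its pieces `s = 0, 1, 2`** (`rk N = 4`). -/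
theorem through_five_sum (hnl : ∀ e ∈ N.E, N.IsNonloop e) (hr : N.eRank = 4) (p b : α) :
    {W ∈ biSpan N 5 | b ∈ W}.ncard =
      (pieceThrough N p b 5 0).ncard + (pieceThrough N p b 5 1).ncard + (pieceThrough N p b 5 2).ncard := by
  classical
  set T := {W ∈ biSpan N 5 | b ∈ W} with hT
  have hTfin : T.Finite := N.ground_finite.finite_subsets.subset (fun _ h => h.1.1)
  have hsub : ∀ s, pieceThrough N p b 5 s ⊆ T := fun s _ h => ⟨h.1, h.2.1⟩
  have hdisj : ∀ s t, s ≠ t → Disjoint (pieceThrough N p b 5 s) (pieceThrough N p b 5 t) := by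
    intro s t hst; rw [Set.disjoint_left]; rintro W ⟨-, -, hs⟩ ⟨-, -, ht⟩; exact hst (hs.symm.trans ht)
  have hcover : T = pieceThrough N p b 5 0 ∪ pieceThrough N p b 5 1 ∪ pieceThrough N p b 5 2 := by
    ext W
    simp only [Set.mem_union, pieceThrough, Set.mem_setOf_eq]
    constructor
    · intro hW
      have hW' := hW
      obtain ⟨⟨hWE, hW5, hWs, -⟩, hbW⟩ := hW'
      have hWfin : W.Finite := N.ground_finite.subset hWE
      have hle : (W ∩ N.closure {p}).ncard ≤ 2 := by
        by_contra hgt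
        push Not at hgt
        rw [Set.two_lt_ncard (hWfin.subset Set.inter_subset_left)] at hgt
        obtain ⟨x, hx, y, hy, z, hz, hxy, hxz, hyz⟩ := hgt
        exact not_three_parallel_of_spanning_five hnl hr hWs hW5 (p := p) hx.1 hy.1 hz.1 hxy hxz hyz hx.2 hy.2 hz.2
      rcases Nat.lt_or_ge (W ∩ N.closure {p}).ncard 1 with h0 | h1
      · exact Or.inl (Or.inl ⟨hW.1, hbW, by omega⟩)
      · rcases Nat.lt_or_ge (W ∩ N.closure {p}).ncard 2 with h1' | h2
        · exact Or.inl (Or.inr ⟨hW.1, hbW, by omega⟩)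
        · exact Or.inr ⟨hW.1, hbW, by omega⟩
    · rintro ((h | h) | h) <;> exact ⟨h.1, h.2.1⟩
  rw [hcover, Set.ncard_union_eq ?_ ((hTfin.subset (hsub 0)).union (hTfin.subset (hsub 1))) (hTfin.subset (hsub 2)),
    Set.ncard_union_eq (hdisj 0 1 (by norm_num)) (hTfin.subset (hsub 0)) (hTfin.subset (hsub 1))]
  exact Set.disjoint_union_left.mpr ⟨hdisj 0 2 (by norm_num), hdisj 1 2 (by norm_num)⟩

/-- **`V_6` is the sum of its pieces `s = 0, 1, 2, 3`** (`rk N = 4`). -/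
theorem avoid_six_sum (hnl : ∀ e ∈ N.E, N.IsNonloop e) (hr : N.eRank = 4) (p b : α) :
    {Z ∈ biSpan N 6 | b ∉ Z}.ncard = (pieceAvoid N p b 6 0).ncard + (pieceAvoid N p b 6 1).ncard +
      (pieceAvoid N p b 6 2).ncard + (pieceAvoid N p b 6 3).ncard := by
  classical
  set V := {Z ∈ biSpan N 6 | b ∉ Z} with hV
  have hVfin : V.Finite := N.ground_finite.finite_subsets.subset (fun _ h => h.1.1)
  have hsub : ∀ s, pieceAvoid N p b 6 s ⊆ V := fun s _ h => ⟨h.1, h.2.1⟩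
  have hdisj : ∀ s t, s ≠ t → Disjoint (pieceAvoid N p b 6 s) (pieceAvoid N p b 6 t) := by
    intro s t hst; rw [Set.disjoint_left]; rintro Z ⟨-, -, hs⟩ ⟨-, -, ht⟩; exact hst (hs.symm.trans ht)
  have hcover : V = pieceAvoid N p b 6 0 ∪ pieceAvoid N p b 6 1 ∪ pieceAvoid N p b 6 2 ∪ pieceAvoid N p b 6 3 := by
    ext Z
    simp only [Set.mem_union, pieceAvoid, Set.mem_setOf_eq]
    constructor
    · intro hZ
      have hZ' := hZ
      obtain ⟨⟨hZE, hZ6, hZs, -⟩, hbZ⟩ := hZ'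
      have hZfin : Z.Finite := N.ground_finite.subset hZE
      have hle : (Z ∩ N.closure {p}).ncard ≤ 3 := by
        by_contra hgt
        push Not at hgt
        rw [Set.three_lt_ncard_iff (hZfin.subset Set.inter_subset_left)] at hgt
        obtain ⟨x, y, z, w, hx, hy, hz, hw, hxy, hxz, hxw, hyz, hyw, hzw⟩ := hgt
        exact not_four_parallel_of_spanning_six hnl hr hZs hZ6 (p := p) hx.1 hy.1 hz.1 hw.1 hxy hxz hyz hxw hyw
          hzw hx.2 hy.2 hz.2 hw.2
      rcases Nat.lt_or_ge (Z ∩ N.closure {p}).ncard 1 with h0 | h1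
      · exact Or.inl (Or.inl (Or.inl ⟨hZ.1, hbZ, by omega⟩))
      · rcases Nat.lt_or_ge (Z ∩ N.closure {p}).ncard 2 with h1' | h2
        · exact Or.inl (Or.inl (Or.inr ⟨hZ.1, hbZ, by omega⟩))
        · rcases Nat.lt_or_ge (Z ∩ N.closure {p}).ncard 3 with h2' | h3
          · exact Or.inl (Or.inr ⟨hZ.1, hbZ, by omega⟩)
          · exact Or.inr ⟨hZ.1, hbZ, by omega⟩
    · rintro (((h | h) | h) | h) <;> exact ⟨h.1, h.2.1⟩
  have f0 := hVfin.subset (hsub 0); have f1 := hVfin.subset (hsub 1)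
  have f2 := hVfin.subset (hsub 2); have f3 := hVfin.subset (hsub 3)
  rw [hcover, Set.ncard_union_eq ?_ ((f0.union f1).union f2) f3, Set.ncard_union_eq ?_ (f0.union f1) f2,
    Set.ncard_union_eq (hdisj 0 1 (by norm_num)) f0 f1]
  · exact Set.disjoint_union_left.mpr ⟨hdisj 0 2 (by norm_num), hdisj 1 2 (by norm_num)⟩
  · exact Set.disjoint_union_left.mpr ⟨Set.disjoint_union_left.mpr ⟨hdisj 0 3 (by norm_num),
      hdisj 1 3 (by norm_num)⟩, hdisj 2 3 (by norm_num)⟩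

/-- A piece with `s > q` is empty. -/
lemma pieceAvoid_eq_empty_of_lt (p b : α) {k s : ℕ} (hs : (N.closure {p}).ncard < s) :
    pieceAvoid N p b k s = ∅ := by
  rw [Set.eq_empty_iff_forall_notMem]
  rintro Z ⟨⟨hZE, -, -, -⟩, -, hZs⟩
  have hPfin : (N.closure {p}).Finite := N.ground_finite.subset (N.closure_subset_ground _)
  have := Set.ncard_le_ncard (Set.inter_subset_right (s := Z) (t := N.closure {p})) hPfin
  omega

/-! ## The evaluations -/

/-- **`T_5 = A_5 + q · g_4 + C(q,2) · g_3` for `q ≥ 3`.** -/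
theorem through_five_eq_of_three_le (hnl : ∀ e ∈ N.E, N.IsNonloop e) (hr : N.eRank = 4) {p : α} (hp : p ∈ N.E)
    (hq : 3 ≤ (N.closure {p}).ncard) {b : α} (hbP : b ∉ N.closure {p}) :
    {W ∈ biSpan N 5 | b ∈ W}.ncard = (upFull N p b 5).ncard +
      (N.closure {p}).ncard * (throughHat N p b 4).ncard +
      (N.closure {p}).ncard.choose 2 * (throughHat N p b 3).ncard := by
  rw [through_five_sum N hnl hr p b, pieceThrough_zero N hnl hp b 5,
    pieceThrough_ncard N hnl hp hbP (k := 5) (s := 1) le_rfl (by omega) (by norm_num),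
    pieceThrough_ncard N hnl hp hbP (k := 5) (s := 2) (by norm_num) (by omega) (by norm_num),
    Nat.choose_one_right]

/-- **`T_5 = A_5 + 2 · g_4 + g_3^{sp}` for `q = 2`.** -/
theorem through_five_eq_of_two (hnl : ∀ e ∈ N.E, N.IsNonloop e) (hr : N.eRank = 4) {p : α} (hp : p ∈ N.E)
    (hq : (N.closure {p}).ncard = 2) {b : α} (hbP : b ∉ N.closure {p}) :
    {W ∈ biSpan N 5 | b ∈ W}.ncard = (upFull N p b 5).ncard + 2 * (throughHat N p b 4).ncard +
      (throughSp N p b 3).ncard := by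
  rw [through_five_sum N hnl hr p b, pieceThrough_zero N hnl hp b 5,
    pieceThrough_ncard N hnl hp hbP (k := 5) (s := 1) le_rfl (by omega) (by norm_num), Nat.choose_one_right, hq]
  have h := pieceThrough_top_ncard N hnl hp hbP (k := 5) (by omega)
  rw [hq] at h
  rw [h]

/-- **`V_6 = Ā_6 + q · ḡ_5 + C(q,2) · ḡ_4 + C(q,3) · ḡ_3` for `q ≥ 4`.** -/
theorem avoid_six_eq_of_four_le (hnl : ∀ e ∈ N.E, N.IsNonloop e) (hr : N.eRank = 4) {p : α} (hp : p ∈ N.E)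
    (hq : 4 ≤ (N.closure {p}).ncard) {b : α} (hbP : b ∉ N.closure {p}) :
    {Z ∈ biSpan N 6 | b ∉ Z}.ncard = (avoidFull N p b 6).ncard +
      (N.closure {p}).ncard * (avoidHat N p b 5).ncard +
      (N.closure {p}).ncard.choose 2 * (avoidHat N p b 4).ncard +
      (N.closure {p}).ncard.choose 3 * (avoidHat N p b 3).ncard := by
  rw [avoid_six_sum N hnl hr p b, pieceAvoid_zero N hnl hp b 6,
    pieceAvoid_ncard N hnl hp hbP (k := 6) (s := 1) le_rfl (by omega) (by norm_num),
    pieceAvoid_ncard N hnl hp hbP (k := 6) (s := 2) (by norm_num) (by omega) (by norm_num),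
    pieceAvoid_ncard N hnl hp hbP (k := 6) (s := 3) (by norm_num) (by omega) (by norm_num),
    Nat.choose_one_right]

/-- **`V_6 = Ā_6 + 3 · ḡ_5 + 3 · ḡ_4 + ḡ_3^{sp}` for `q = 3`.** -/
theorem avoid_six_eq_of_three (hnl : ∀ e ∈ N.E, N.IsNonloop e) (hr : N.eRank = 4) {p : α} (hp : p ∈ N.E)
    (hq : (N.closure {p}).ncard = 3) {b : α} (hbP : b ∉ N.closure {p}) :
    {Z ∈ biSpan N 6 | b ∉ Z}.ncard = (avoidFull N p b 6).ncard + 3 * (avoidHat N p b 5).ncard +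
      3 * (avoidHat N p b 4).ncard + (avoidSp N p b 3).ncard := by
  rw [avoid_six_sum N hnl hr p b, pieceAvoid_zero N hnl hp b 6,
    pieceAvoid_ncard N hnl hp hbP (k := 6) (s := 1) le_rfl (by omega) (by norm_num),
    pieceAvoid_ncard N hnl hp hbP (k := 6) (s := 2) (by norm_num) (by omega) (by norm_num),
    Nat.choose_one_right, hq]
  have h := pieceAvoid_top_ncard N hnl hp hbP (k := 6) (by omega)
  rw [hq] at h
  rw [h]
  norm_num

/-- **`V_6 = Ā_6 + 2 · ḡ_5 + ḡ_4^{sp}` for `q = 2`.** -/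
theorem avoid_six_eq_of_two (hnl : ∀ e ∈ N.E, N.IsNonloop e) (hr : N.eRank = 4) {p : α} (hp : p ∈ N.E)
    (hq : (N.closure {p}).ncard = 2) {b : α} (hbP : b ∉ N.closure {p}) :
    {Z ∈ biSpan N 6 | b ∉ Z}.ncard = (avoidFull N p b 6).ncard + 2 * (avoidHat N p b 5).ncard +
      (avoidSp N p b 4).ncard := by
  rw [avoid_six_sum N hnl hr p b, pieceAvoid_zero N hnl hp b 6,
    pieceAvoid_ncard N hnl hp hbP (k := 6) (s := 1) le_rfl (by omega) (by norm_num), Nat.choose_one_right,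
    pieceAvoid_eq_empty_of_lt N p b (k := 6) (s := 3) (by omega), Set.ncard_empty, hq]
  have h := pieceAvoid_top_ncard N hnl hp hbP (k := 6) (by omega)
  rw [hq] at h
  rw [h]
  norm_num

/-! ## The transport of the new families along parallel copies of `p` -/

omit [N.Finite] in
/-- **`g_k^{sp}` is unchanged by deleting parallel copies of `p`.** -/
lemma throughSp_delete_parallel {p : α} (hp : p ∈ N.E) {D : Set α} (hD : D ⊆ N.closure {p}) (hpD : p ∉ D)
    (b : α) (k : ℕ) : throughSp (N.delete D) p b k = throughSp N p b k := by
  have hco := coindep_of_subset_closure_of_notMem N hp hD hpD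
  have hE' := delete_ground_sdiff_closure N hD hpD
  ext W
  simp only [throughSp, Set.mem_setOf_eq, hE']
  constructor
  · rintro ⟨h1, h2, h3, h4, h5⟩
    refine ⟨h1, h2, h3, ?_, ?_⟩
    · exact (delete_spanning_iff_of_disjoint N hco (disjoint_insert_of_subset_sdiff_closure N hD hpD h1)).mp h4
    · exact (delete_spanning_iff_of_disjoint N hco (disjoint_of_subset_sdiff_closure N hD Set.sdiff_subset)).mp h5
  · rintro ⟨h1, h2, h3, h4, h5⟩
    refine ⟨h1, h2, h3, ?_, ?_⟩
    · exact (delete_spanning_iff_of_disjoint N hco (disjoint_insert_of_subset_sdiff_closure N hD hpD h1)).mpr h4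
    · exact (delete_spanning_iff_of_disjoint N hco (disjoint_of_subset_sdiff_closure N hD Set.sdiff_subset)).mpr h5

omit [N.Finite] in
/-- **`ḡ_k^{sp}` is unchanged by deleting parallel copies of `p`.** -/
lemma avoidSp_delete_parallel {p : α} (hp : p ∈ N.E) {D : Set α} (hD : D ⊆ N.closure {p}) (hpD : p ∉ D)
    (b : α) (k : ℕ) : avoidSp (N.delete D) p b k = avoidSp N p b k := by
  have hco := coindep_of_subset_closure_of_notMem N hp hD hpD
  have hE' := delete_ground_sdiff_closure N hD hpD
  ext W
  simp only [avoidSp, Set.mem_setOf_eq, hE']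
  constructor
  · rintro ⟨h1, h2, h3, h4, h5⟩
    refine ⟨h1, h2, h3, ?_, ?_⟩
    · exact (delete_spanning_iff_of_disjoint N hco (disjoint_insert_of_subset_sdiff_closure N hD hpD h1)).mp h4
    · exact (delete_spanning_iff_of_disjoint N hco (disjoint_of_subset_sdiff_closure N hD Set.sdiff_subset)).mp h5
  · rintro ⟨h1, h2, h3, h4, h5⟩
    refine ⟨h1, h2, h3, ?_, ?_⟩
    · exact (delete_spanning_iff_of_disjoint N hco (disjoint_insert_of_subset_sdiff_closure N hD hpD h1)).mpr h4
    · exact (delete_spanning_iff_of_disjoint N hco (disjoint_of_subset_sdiff_closure N hD Set.sdiff_subset)).mpr h5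

/-! ## The named residue and `g_4 ≤ ḡ_5` -/

omit [N.Finite] in
/-- **THE RESIDUE (C1) OF THE SERIES-TRIPLE CASE OF (↑)₅** (night-1 g39; a `Prop`, NOT asserted):
`g_3 + ḡ_4^{sp} ≤ ḡ_4 + ḡ_3^{sp} + g_3^{sp}` — the through-`b` bi-spanning `3`-sets of the contraction plus the
avoid-`b` `4`-sets spanning with `p` whose complement spans without `p` are at most the avoid-`b` bi-spanning
`4`-sets of the contraction plus the `3`-sets (avoiding or through `b`) spanning with `p` whose complement spans
without `p`. Census: 0 failures on 800,427 random instances (kits j334831, j334836). -/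
def UpFiveResidue (p b : α) : Prop :=
  (throughHat N p b 3).ncard + (avoidSp N p b 4).ncard ≤
    (avoidHat N p b 4).ncard + (avoidSp N p b 3).ncard + (throughSp N p b 3).ncard

variable (M : Matroid α) [M.Finite]

/-- **`g_4 ≤ ḡ_5` when `#(E ∖ cl✶ {p}) ≥ 10`**: (↑) at level `4` of the coloop-free nullity-`3` deletion
`M ＼ cl✶ {p}` (`upAt_of_nullity_three`). -/
lemma throughHat_four_le_avoidHat_five (hcol : ∀ e, ¬ M.IsColoop e) (hν : M✶.eRank = 4) {p : α}
    (hp : p ∈ M.E) {b : α} (hb : b ∈ M.E) (hbP : b ∉ M✶.closure {p})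
    (h10 : 10 ≤ (M.E \ M✶.closure {p}).ncard) :
    (throughHat M✶ p b 4).ncard ≤ (avoidHat M✶ p b 5).ncard := by
  rw [throughHat_eq_biIndep_delete M hcol hp, avoidHat_eq_biIndep_delete M hcol hp]
  have hpnl : M✶.IsNonloop p := dual_isNonloop_of_coloopFree M hcol hp
  have hr : (M.delete (M✶.closure {p}))✶.eRank ≤ 3 := by
    have := eRank_dual_delete_seriesClass_add_one_le M hpnl
    rw [hν] at this
    have h3 : (3 : ℕ∞) + 1 = 4 := by norm_num
    rw [← h3] at this
    exact (WithTop.add_le_add_iff_right (by decide)).mp this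
  have hbE : b ∈ (M.delete (M✶.closure {p})).E := ⟨hb, hbP⟩
  have hn : 2 * 4 + 2 ≤ (M.delete (M✶.closure {p})).E.ncard := by
    rw [Matroid.delete_ground]; exact h10
  exact upAt_of_nullity_three (M.delete (M✶.closure {p})) (delete_seriesClass_coloopFree M p) hr hbE (by norm_num) hn

end PercRepro
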